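import Literature.Algebra.Module.DivisibleTorsionMultiplicativity
import Literature.NumberTheory.NumberFields.IdealClassCoprimeRepresentative
import HarnessLib

/-!
# The `I`-torsion of a divisible group with `𝒪`-action is ONE translate of its `IJ`-torsion: `M[I] = φ(j)·M[IJ]` for a single `j ∈ J`
# ([AtiyahMacdonald1969] Prop. 1.10 and Ch. 9; [NeukirchANT1999] Ch. I §3; [GortzWedhorn2023] Prop. 27.188 (2))

Topic `Literature/Algebra/Module`; namespace `Literature.Algebra.Module.DivisibleTorsionIdealImage` (sequel of ★ `DivisibleTorsionPointCount`,
★ `DivisibleTorsionMultiplicativity`; same multiplicative currency `φ : 𝒪 → M → M`, `M[𝔞] = {x ∣ φ(r) x = 1 ∀ r ∈ 𝔞}`).  THEOREMS ONLY (no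
definition, no named fact, no `instance`, no notation, no `sorry`).  Cell `hodgecm-mathlib` (D-0151), P6 «MOD» (crux hLiu418 =
stmt-HodgeConjecture-24832, `--supports`, count-neutral): line L3 (`stub_FROB`), ROOF road «DUAL-B̄», LA3-plan RULING #3, the ISOTROPY organ
«`ē^Θ_n(A[𝔟](κ̄), A[n𝔟̄⁻¹](κ̄)) = 1`» of the non-Lagrangian quotient-dual engine, step **(DEC) «`A[𝔠](κ̄) = ι(𝔟̄)·A[n](κ̄)` for `𝔠·𝔟̄ = (n)`»**
— as PURE ALGEBRA, with NO freeness or counting input.  HC_CM is proved only modulo the printed citations until rung 0 closes; this file is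
generic and changes no count.

THE MATHEMATICS.  Let `M` be a group with an additive, multiplicative, unital family of commuting endomorphisms `φ : 𝒪 → End M` over a
DEDEKIND domain `𝒪`, every `φ(r)`, `r ≠ 0`, SURJECTIVE (the isogenies `ι(r)` of an abelian variety on points over an algebraically closed
field), and `I`, `J` ideals, `J ≠ 0`.  Trivially `φ(j)·M[IJ] ⊆ M[I]` for every `j ∈ J` (★ `torsion_mul_left_of_mem`).  CONVERSELY there is ONE
`j ∈ J` with **`φ(j) : M[IJ] ↠ M[I]` surjective**: move `J` off the primes of `IJ` inside its class — `J·𝔞 = (j)` with `𝔞 + IJ = 𝒪`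
(★ `NumberFields.exists_mul_eq_span_and_forall_not_dvd`, ★ `sup_eq_top_iff_forall_not_dvd`; [NeukirchANT1999] I §3); for `x ∈ M[I]` lift
`x = φ(j)y₀`; then `y₀ ∈ M[I·(j)] = M[IJ·𝔞]` (`φ(i·j)y₀ = φ(i)x = 1`), so by the Chinese remainder theorem (★ `exists_mul_eq_of_sup_eq_top`,
[AtiyahMacdonald1969] Prop. 1.10) `y₀ = y·z` with `y ∈ M[IJ]`, `z ∈ M[𝔞]`, and `φ(j)z = 1` because `j ∈ 𝔞`; hence `x = φ(j)y`.  (For `I = 0`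
any nonzero `j ∈ J` works.)  In particular `M[I] = φ(j)(M[IJ]) ⊆ ⟨φ(J)·M[IJ]⟩`, and when `IJ = (a)`: every `x ∈ M[I]` is `φ(j)y` with `φ(a)y = 1`.

* §1 `apply_mem_torsion_of_mem` (`φ(j)·M[IJ] ⊆ M[I]`, the ★ projection re-exported in this file's words), `map_zero_apply` (`φ(0)x = 1`);
* §2 **`exists_mem_forall_torsion_exists_apply_eq`** (THE HEAD: one `j ∈ J` with `φ(j) : M[IJ] ↠ M[I]`), `exists_mem_image_torsion_eq`
  (set form `φ(j) '' M[IJ] = M[I]`), `exists_mem_forall_torsion_exists_apply_eq_of_mul_eq_span` (`IJ = (a)`: `y` with `φ(a)y = 1`).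
* §3 (ed. 2) **`exists_mem_forall_torsion_exists_apply_eq_of_sup_eq_top`** — the same `j` with its auxiliary ideal RECORDED and moved off ANY given
  nonzero `m`: `(j) = J·𝔞`, `𝔞 ⊔ m = ⊤` (so two applications give `𝔞₁ ⊔ 𝔞₂ = ⊤`, `(j₁)+(j₂) ⊇ J·(𝔞₁+𝔞₂) = J` — the form the annihilator identity
  `A[𝔟]^⊥ = A[𝔠]` consumes); `…_of_sup_eq_top_of_mul_eq_span` (`IJ = (a)`).

## References
* [AtiyahMacdonald1969] M. F. Atiyah, I. G. Macdonald, *Introduction to Commutative Algebra* (1969) — Prop. 1.10 (p. 7); Ch. 9, Cor. 9.4 (p. 95).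
* [NeukirchANT1999] J. Neukirch, *Algebraic Number Theory* (1999) — Ch. I §3 (unique factorisation of ideals; approximation in Dedekind domains).
* [GortzWedhorn2023] U. Görtz, T. Wedhorn, *Algebraic Geometry II* (2023) — Prop. 27.188 (2) (torsion points of abelian varieties; the currency).
-/

set_option autoImplicit false

namespace Literature.Algebra.Module.DivisibleTorsionIdealImage

open Literature.Algebra.Module.DivisibleTorsionPointCount Literature.Algebra.Module.DivisibleTorsionMultiplicativity
  Literature.NumberTheory.NumberFields

variable {M : Type*} [Group M] {O : Type*} [CommRing O]

/-! ## §1 The easy inclusion `φ(j)·M[IJ] ⊆ M[I]` and `φ(0) = 1` -/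

/-- `φ(j) y ∈ M[I]` for `y ∈ M[IJ]` and `j ∈ J` (★ `torsion_mul_left_of_mem`). [cite: AtiyahMacdonald1969, Prop. 1.10 (p. 7)] -/
theorem apply_mem_torsion_of_mem (φ : O → M → M) (hcomp : ∀ r s x, φ (r * s) x = φ r (φ s x)) {I J : Ideal O} {y : M}
    (hy : ∀ r ∈ I * J, φ r y = 1) {j : O} (hj : j ∈ J) : ∀ r ∈ I, φ r (φ j y) = 1 :=
  torsion_mul_left_of_mem φ hcomp hy hj

/-- `φ(0) x = 1` for an additive family (`φ(0)x = φ(0)x · φ(0)x`). [cite: GortzWedhorn2023, Prop. 27.188 (2)] -/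
theorem map_zero_apply (φ : O → M → M) (hadd : ∀ r s x, φ (r + s) x = φ r x * φ s x) (x : M) : φ 0 x = 1 := by
  have h := hadd 0 0 x
  rw [add_zero] at h
  exact left_eq_mul.mp h

/-! ## §2 One `j ∈ J` with `φ(j) : M[IJ] ↠ M[I]` -/

section Dedekind

variable [IsDedekindDomain O] (φ : O → M → M) (hmul : ∀ r x y, φ r (x * y) = φ r x * φ r y)
  (hadd : ∀ r s x, φ (r + s) x = φ r x * φ s x) (hcomp : ∀ r s x, φ (r * s) x = φ r (φ s x)) (hone : ∀ x, φ 1 x = x)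
  (hsurj : ∀ r : O, r ≠ 0 → Function.Surjective (φ r))

include hmul hadd hcomp hone hsurj in
/-- **THE HEAD — `M[I] = φ(j)·M[IJ]` for ONE `j ∈ J`.**  For a group `M` with an additive, multiplicative, unital family of endomorphisms
`φ : 𝒪 → End M` over a Dedekind domain `𝒪` with every `φ(r)`, `r ≠ 0`, surjective, and ideals `I`, `J ≠ 0`: there is `j ∈ J` such that every
`x ∈ M[I]` is `φ(j) y` for some `y ∈ M[IJ]`.  (`J·𝔞 = (j)` with `𝔞 + IJ = 𝒪`; lift `x = φ(j)y₀`; `y₀ ∈ M[IJ·𝔞] = M[IJ]·M[𝔞]` by CRT; `φ(j)` kills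
`M[𝔞]`.)  Applied to the `κ̄`-points of a CM abelian variety: `A[𝔠](κ̄) = ι(j)·A[n](κ̄) ⊆ ι(𝔟̄)·A[n](κ̄)` for `𝔠·𝔟̄ = (n)`.
[cite: AtiyahMacdonald1969, Prop. 1.10 (p. 7) and Cor. 9.4 (p. 95)] [cite: NeukirchANT1999, Ch. I §3] -/
theorem exists_mem_forall_torsion_exists_apply_eq {I J : Ideal O} (hJ : J ≠ ⊥) :
    ∃ j ∈ J, ∀ x : M, (∀ r ∈ I, φ r x = 1) → ∃ y : M, (∀ r ∈ I * J, φ r y = 1) ∧ φ j y = x := by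
  classical
  by_cases hI : I = ⊥
  · -- `I = 0`: `M[I] = M = M[IJ]`, any nonzero `j ∈ J` works
    subst hI
    obtain ⟨j, hjJ, hj0⟩ := Submodule.exists_mem_ne_zero_of_ne_bot hJ
    refine ⟨j, hjJ, fun x _ => ?_⟩
    obtain ⟨y, hy⟩ := hsurj j hj0 x
    refine ⟨y, fun r hr => ?_, hy⟩
    rw [Ideal.bot_mul, Ideal.mem_bot] at hr
    rw [hr]
    exact map_zero_apply φ hadd y
  · have hm : I * J ≠ ⊥ := mul_ne_zero hI hJ
    -- move `J` off the primes of `IJ` inside its ideal class: `J·𝔞 = (a)`, `𝔞 + IJ = 𝒪`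
    obtain ⟨a, 𝔞, ha0, hJa, h𝔞S⟩ := exists_mul_eq_span_and_forall_not_dvd J hJ (Ideal.finite_factors hm).toFinset
    have h𝔞m : 𝔞 ⊔ I * J = ⊤ :=
      (sup_eq_top_iff_forall_not_dvd hm).mpr fun w hw => h𝔞S w ((Set.Finite.mem_toFinset _).mpr hw)
    have haJ𝔞 : a ∈ J * 𝔞 := by
      rw [hJa]
      exact Ideal.mem_span_singleton_self a
    have haJ : a ∈ J := Ideal.mul_le_right haJ𝔞
    have ha𝔞 : a ∈ 𝔞 := Ideal.mul_le_left haJ𝔞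
    refine ⟨a, haJ, fun x hx => ?_⟩
    obtain ⟨y₀, hy₀⟩ := hsurj a ha0 x
    -- `y₀ ∈ M[I·(a)] = M[(IJ)·𝔞]`
    have hy₀t : ∀ r ∈ (I * J) * 𝔞, φ r y₀ = 1 := by
      intro r hr
      rw [mul_assoc, hJa, Ideal.mem_mul_span_singleton] at hr
      obtain ⟨i, hi, rfl⟩ := hr
      rw [hcomp, hy₀]
      exact hx i hi
    -- CRT: `y₀ = y·z`, `y ∈ M[IJ]`, `z ∈ M[𝔞]`
    obtain ⟨y, z, hy, hz, hyz⟩ :=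
      exists_mul_eq_of_sup_eq_top φ hadd hcomp hone (I := I * J) (J := 𝔞) (by rwa [sup_comm]) hy₀t
    refine ⟨y, hy, ?_⟩
    rw [← hy₀, ← hyz, hmul, hz a ha𝔞, mul_one]

include hmul hadd hcomp hone hsurj in
/-- **Set form: `φ(j)(M[IJ]) = M[I]` for one `j ∈ J`** (`⊇` is §1). [cite: AtiyahMacdonald1969, Prop. 1.10 (p. 7) and Cor. 9.4 (p. 95)] -/
theorem exists_mem_image_torsion_eq {I J : Ideal O} (hJ : J ≠ ⊥) :
    ∃ j ∈ J, φ j '' {y : M | ∀ r ∈ I * J, φ r y = 1} = {x | ∀ r ∈ I, φ r x = 1} := by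
  obtain ⟨j, hjJ, hj⟩ := exists_mem_forall_torsion_exists_apply_eq φ hmul hadd hcomp hone hsurj (I := I) hJ
  refine ⟨j, hjJ, Set.Subset.antisymm ?_ fun x hx => ?_⟩
  · rintro _ ⟨y, hy, rfl⟩
    exact apply_mem_torsion_of_mem φ hcomp hy hjJ
  · obtain ⟨y, hy, hyx⟩ := hj x hx
    exact ⟨y, hy, hyx⟩

include hmul hadd hcomp hone hsurj in
/-- **Principal-product form**: if `I·J = (a)` (e.g. `𝔠·𝔟̄ = (n)`) then one `j ∈ J` has: every `x ∈ M[I]` is `φ(j)y` with `φ(a)y = 1` (`M[(a)] = Ker φ(a)`,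
★ `torsion_span_singleton_iff`) — «`A[𝔠](κ̄) ⊆ ι(𝔟̄)·A[n](κ̄)`». [cite: AtiyahMacdonald1969, Prop. 1.10 (p. 7) and Cor. 9.4 (p. 95)] -/
theorem exists_mem_forall_torsion_exists_apply_eq_of_mul_eq_span {I J : Ideal O} (hJ : J ≠ ⊥) {a : O} (hIJ : I * J = Ideal.span {a}) :
    ∃ j ∈ J, ∀ x : M, (∀ r ∈ I, φ r x = 1) → ∃ y : M, φ a y = 1 ∧ φ j y = x := by
  obtain ⟨j, hjJ, hj⟩ := exists_mem_forall_torsion_exists_apply_eq φ hmul hadd hcomp hone hsurj (I := I) hJ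
  refine ⟨j, hjJ, fun x hx => ?_⟩
  obtain ⟨y, hy, hyx⟩ := hj x hx
  rw [hIJ] at hy
  exact ⟨y, (torsion_span_singleton_iff φ hmul hcomp a y).mp hy, hyx⟩

end Dedekind

/-! ## §3 (ed. 2) The same `j`, with its auxiliary ideal recorded and moved off a given `m` -/

section DedekindAux

variable [IsDedekindDomain O] (φ : O → M → M) (hmul : ∀ r x y, φ r (x * y) = φ r x * φ r y)
  (hadd : ∀ r s x, φ (r + s) x = φ r x * φ s x) (hcomp : ∀ r s x, φ (r * s) x = φ r (φ s x)) (hone : ∀ x, φ 1 x = x)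
  (hsurj : ∀ r : O, r ≠ 0 → Function.Surjective (φ r))

include hmul hadd hcomp hone hsurj in
/-- **`M[I] = φ(j)·M[IJ]` with `(j) = J·𝔞`, `𝔞` prime to `IJ` AND to a given nonzero `m`.**  Same proof as the head (★ `exists_mul_eq_span_and_forall_not_dvd` off
the primes of `IJ·m`); recording `𝔞` lets a consumer run the lemma twice with `𝔞₂ ⊔ 𝔞₁ = ⊤`, so that the two generators satisfy
`(j₁) + (j₂) = J·(𝔞₁ + 𝔞₂) = J`. (`I ≠ 0` here; for `I = 0` the head already gives everything.)
[cite: AtiyahMacdonald1969, Prop. 1.10 (p. 7) and Cor. 9.4 (p. 95)] [cite: NeukirchANT1999, Ch. I §3] -/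
theorem exists_mem_forall_torsion_exists_apply_eq_of_sup_eq_top {I J m : Ideal O} (hI : I ≠ ⊥) (hJ : J ≠ ⊥) (hm : m ≠ ⊥) :
    ∃ j ∈ J, ∃ 𝔞 : Ideal O, J * 𝔞 = Ideal.span {j} ∧ 𝔞 ⊔ m = ⊤ ∧ 𝔞 ⊔ I * J = ⊤ ∧
      ∀ x : M, (∀ r ∈ I, φ r x = 1) → ∃ y : M, (∀ r ∈ I * J, φ r y = 1) ∧ φ j y = x := by
  classical
  have hIJ : I * J ≠ ⊥ := mul_ne_zero hI hJ
  have hIJm : I * J * m ≠ ⊥ := mul_ne_zero hIJ hm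
  -- move `J` off the primes of `IJ·m` inside its ideal class: `J·𝔞 = (a)`
  obtain ⟨a, 𝔞, ha0, hJa, h𝔞S⟩ := exists_mul_eq_span_and_forall_not_dvd J hJ (Ideal.finite_factors hIJm).toFinset
  have h𝔞' : 𝔞 ⊔ I * J * m = ⊤ :=
    (sup_eq_top_iff_forall_not_dvd hIJm).mpr fun w hw => h𝔞S w ((Set.Finite.mem_toFinset _).mpr hw)
  have h𝔞m : 𝔞 ⊔ m = ⊤ := by
    refine top_le_iff.mp (h𝔞'.symm.le.trans (sup_le le_sup_left (le_trans Ideal.mul_le_left le_sup_right)))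
  have h𝔞IJ : 𝔞 ⊔ I * J = ⊤ := by
    refine top_le_iff.mp (h𝔞'.symm.le.trans (sup_le le_sup_left (le_trans Ideal.mul_le_right le_sup_right)))
  have haJ𝔞 : a ∈ J * 𝔞 := by
    rw [hJa]
    exact Ideal.mem_span_singleton_self a
  have haJ : a ∈ J := Ideal.mul_le_right haJ𝔞
  have ha𝔞 : a ∈ 𝔞 := Ideal.mul_le_left haJ𝔞
  refine ⟨a, haJ, 𝔞, hJa, h𝔞m, h𝔞IJ, fun x hx => ?_⟩
  obtain ⟨y₀, hy₀⟩ := hsurj a ha0 x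
  have hy₀t : ∀ r ∈ (I * J) * 𝔞, φ r y₀ = 1 := by
    intro r hr
    rw [mul_assoc, hJa, Ideal.mem_mul_span_singleton] at hr
    obtain ⟨i, hi, rfl⟩ := hr
    rw [hcomp, hy₀]
    exact hx i hi
  obtain ⟨y, z, hy, hz, hyz⟩ :=
    exists_mul_eq_of_sup_eq_top φ hadd hcomp hone (I := I * J) (J := 𝔞) (by rwa [sup_comm]) hy₀t
  refine ⟨y, hy, ?_⟩
  rw [← hy₀, ← hyz, hmul, hz a ha𝔞, mul_one]

include hmul hadd hcomp hone hsurj in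
/-- **Principal-product form of §3**: `IJ = (a)` ⇒ one `j ∈ J` with `(j) = J·𝔞`, `𝔞 ⊔ m = ⊤`, `𝔞 ⊔ IJ = ⊤`, and every `x ∈ M[I]` is `φ(j)y` with `φ(a)y = 1`.
[cite: AtiyahMacdonald1969, Prop. 1.10 (p. 7) and Cor. 9.4 (p. 95)] -/
theorem exists_mem_forall_torsion_exists_apply_eq_of_sup_eq_top_of_mul_eq_span {I J m : Ideal O} (hI : I ≠ ⊥) (hJ : J ≠ ⊥)
    (hm : m ≠ ⊥) {a : O} (hIJ : I * J = Ideal.span {a}) :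
    ∃ j ∈ J, ∃ 𝔞 : Ideal O, J * 𝔞 = Ideal.span {j} ∧ 𝔞 ⊔ m = ⊤ ∧ 𝔞 ⊔ I * J = ⊤ ∧
      ∀ x : M, (∀ r ∈ I, φ r x = 1) → ∃ y : M, φ a y = 1 ∧ φ j y = x := by
  obtain ⟨j, hjJ, 𝔞, hj𝔞, h𝔞m, h𝔞IJ, hj⟩ :=
    exists_mem_forall_torsion_exists_apply_eq_of_sup_eq_top φ hmul hadd hcomp hone hsurj (I := I) hI hJ hm
  refine ⟨j, hjJ, 𝔞, hj𝔞, h𝔞m, h𝔞IJ, fun x hx => ?_⟩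
  obtain ⟨y, hy, hyx⟩ := hj x hx
  rw [hIJ] at hy
  exact ⟨y, (torsion_span_singleton_iff φ hmul hcomp a y).mp hy, hyx⟩

end DedekindAux

end Literature.Algebra.Module.DivisibleTorsionIdealImage
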